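import Mathlib.Analysis.Calculus.InverseFunctionTheorem.ApproximatesLinearOn
import Mathlib.Topology.MetricSpace.Contracting
import HarnessLib

/-!
# `AlphaInputsT3ACv3NewtonShell` — STRATEGY B for 2′, the (FL) row under OWNER RULING g24-№4 («(FL) ⇐ `hLift` ⇐ Newton∕IFT on the (LL) engine»):
# **THE NEWTON∕IFT SHELL WITH AN *APPROXIMATE* RIGHT INVERSE, SOLUTION IN `range R`** — lane `pub-balaban3d` ∕ cell `ym3-torus`, seat `ym-ust-19936-w4` (g0)

WHY (cell `ym3-torus` STATUS 2026-08-28: RULING g24-№4 + DEPMAP v3.5; this seat's STARTED∕CLAIM (N)).  The regular exact `k`-fold lift of a level-`k` datum `V` on the free-seam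
region `Ω_{k+1}(h)` (the binder `hLift` of `…v3InnerLiftFromRegionalThm1.innerFineLiftsT3_of_regionalLifts`) is to be produced KINEMATICALLY: a candidate `U₀` with small exactness
defect and fine plaquettes `O(ε·L^{−2k})`, then a correction `U = e^{a}·U₀` solving the (finitely many, smooth) exactness equations `Φ(a) = 0`.  The linear (0.4) engine
(`LinearLiftSpread.lift`, `linAvgIter_lift : linAvgIter k (lift k A) = A`, alpha-2's regional form, w3's matrix port) inverts the FLAT linearised average; the derivative of the
non-linear `k`-fold `exp[mean log]` average at the candidate is that flat average only AFTER rotation into local frames and up to an `O(ε)` curvature∕frame error.  So the fixed-point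
step needs a quantitative surjectivity theorem in which
* the map `Φ` is approximated on a ball by SOME bounded linear `T` (Lipschitz bound `c` on `Φ − T`),
* the available operator `R` is only an APPROXIMATE right inverse of `T` (`‖T(Ru) − u‖ ≤ κ‖u‖`, `κ + c‖R‖ < 1`), and
* the zero is exhibited INSIDE `range R` (as `R u` with `‖u‖` controlled) — the curl of a lifted correction is bounded through the curl of its coarse input
  (`LinearLiftSpread.curlAt_lift`, gain `L^{−2k}`), whereas a bare norm bound on the correction only gives `L^{−k}`.
Mathlib's `ApproximatesLinearOn.surjOn_closedBall_of_nonlinearRightInverse` asks for a right inverse of THE SAME `f'` and does not place the preimage in `x₀ + range R`; THIS FILE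
supplies the variant the row needs, by the Banach fixed-point theorem for `u ↦ u − Φ(Ru)` on a closed ball of the (complete) target:
* §1 `lipschitz_defectMap`, `mapsTo_defectMap` — the contraction estimate `‖F u − F u′‖ ≤ (κ + c‖R‖)‖u − u′‖` and the self-map property of the closed `ρ`-ball;
* §2 ★★ `exists_zero_in_range_of_approxRightInverse` — `∃ u, ‖u‖ ≤ ρ ∧ Φ (R u) = 0`, with the a-posteriori bound `‖u‖ ≤ ‖Φ 0‖ ∕ (1 − κ − c‖R‖)`;
  `exists_zero_in_range_of_approxRightInverse'` — the same from Mathlib's `ApproximatesLinearOn Φ T (closedBall 0 r) c`; `norm_comp_sub_le_of_opNorm` — the hypothesis on `R`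
  from an operator-norm bound `‖T ∘ R − 1‖ ≤ κ`.
Pure functional analysis (any complete normed target over a nontrivially normed field); no lattice objects.  HONEST FRAMING: a helper toward R3 2′ (items 19936∕19935); (FL) is NOT
proved here; registry untouched; nothing about d = 4, the continuum, or a mass gap; YM₃ on T³ is rung R3, not Clay.

References: L. M. Graves, Duke Math. J. 17 (1950) 111–114 (the surjectivity theorem behind Mathlib's `ApproximatesLinearOn`); T. Bałaban, Commun. Math. Phys. 102 (1985) 277–309
[Balaban1985Variational] ((8), (11)–(14) pp.279–280: the regular exact lift this shell serves).
-/

set_option autoImplicit false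

namespace Summit.QuantumFields.YangMills.Theorems.NewtonShell

open Metric Set

variable {𝕜 : Type*} [NontriviallyNormedField 𝕜]
variable {E : Type*} [NormedAddCommGroup E] [NormedSpace 𝕜 E]
variable {G : Type*} [NormedAddCommGroup G] [NormedSpace 𝕜 G]

/-! ## §1 The defect map `u ↦ u − Φ (R u)`: Lipschitz constant and self-map of a closed ball -/

/-- **THE CONTRACTION ESTIMATE.**  If `Φ − T` is `c`-Lipschitz on the closed `r`-ball of `E` (`‖Φ x′ − Φ x − T (x′ − x)‖ ≤ c‖x′ − x‖`), `R` maps into that ball from the closed `ρ`-ball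
of `G` (`‖R‖·ρ ≤ r`) and `R` is a `κ`-approximate right inverse of `T` (`‖T (R u) − u‖ ≤ κ‖u‖`), then `F u := u − Φ (R u)` satisfies `‖F u − F u′‖ ≤ (κ + c‖R‖)·‖u − u′‖` on the
`ρ`-ball: `F u − F u′ = −[Φ(Ru) − Φ(Ru′) − T(Ru − Ru′)] − [T(R(u − u′)) − (u − u′)]`. [folklore] -/
theorem norm_defectMap_sub_le (Φ : E → G) (T : E →L[𝕜] G) (R : G →L[𝕜] E) {c κ ρ r : ℝ}
    (hΦ : ∀ x ∈ closedBall (0 : E) r, ∀ x' ∈ closedBall (0 : E) r, ‖Φ x' - Φ x - T (x' - x)‖ ≤ c * ‖x' - x‖)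
    (hR : ∀ u : G, ‖T (R u) - u‖ ≤ κ * ‖u‖) (hc : 0 ≤ c) (hρr : ‖R‖ * ρ ≤ r)
    {u u' : G} (hu : ‖u‖ ≤ ρ) (hu' : ‖u'‖ ≤ ρ) :
    ‖(u - Φ (R u)) - (u' - Φ (R u'))‖ ≤ (κ + c * ‖R‖) * ‖u - u'‖ := by
  have hRu : R u ∈ closedBall (0 : E) r := by
    rw [mem_closedBall, dist_zero_right]
    exact (R.le_opNorm u).trans ((mul_le_mul_of_nonneg_left hu (norm_nonneg _)).trans hρr)
  have hRu' : R u' ∈ closedBall (0 : E) r := by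
    rw [mem_closedBall, dist_zero_right]
    exact (R.le_opNorm u').trans ((mul_le_mul_of_nonneg_left hu' (norm_nonneg _)).trans hρr)
  have h1 : ‖Φ (R u) - Φ (R u') - T (R u - R u')‖ ≤ c * ‖R u - R u'‖ := hΦ (R u') hRu' (R u) hRu
  have h2 : ‖T (R (u - u')) - (u - u')‖ ≤ κ * ‖u - u'‖ := hR (u - u')
  have h3 : ‖R u - R u'‖ ≤ ‖R‖ * ‖u - u'‖ := by
    rw [← map_sub]; exact R.le_opNorm _
  have key : (u - Φ (R u)) - (u' - Φ (R u')) = -(Φ (R u) - Φ (R u') - T (R u - R u')) - (T (R (u - u')) - (u - u')) := by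
    rw [map_sub R u u', map_sub T]; abel
  rw [key]
  calc ‖-(Φ (R u) - Φ (R u') - T (R u - R u')) - (T (R (u - u')) - (u - u'))‖
      ≤ ‖-(Φ (R u) - Φ (R u') - T (R u - R u'))‖ + ‖T (R (u - u')) - (u - u')‖ := norm_sub_le _ _
    _ ≤ c * ‖R u - R u'‖ + κ * ‖u - u'‖ := by rw [norm_neg]; exact add_le_add h1 h2
    _ ≤ c * (‖R‖ * ‖u - u'‖) + κ * ‖u - u'‖ := by gcongr
    _ = (κ + c * ‖R‖) * ‖u - u'‖ := by ring

/-- **THE SELF-MAP PROPERTY.**  Under the hypotheses of `norm_defectMap_sub_le` and the SMALL-DEFECT condition `‖Φ 0‖ ≤ (1 − (κ + c‖R‖))·ρ`, the map `u ↦ u − Φ (R u)` sends the closed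
`ρ`-ball of `G` into itself (`‖F u‖ ≤ ‖F u − F 0‖ + ‖F 0‖`, `F 0 = −Φ 0`). [folklore] -/
theorem norm_defectMap_le (Φ : E → G) (T : E →L[𝕜] G) (R : G →L[𝕜] E) {c κ ρ r : ℝ}
    (hΦ : ∀ x ∈ closedBall (0 : E) r, ∀ x' ∈ closedBall (0 : E) r, ‖Φ x' - Φ x - T (x' - x)‖ ≤ c * ‖x' - x‖)
    (hR : ∀ u : G, ‖T (R u) - u‖ ≤ κ * ‖u‖) (hκ : 0 ≤ κ) (hc : 0 ≤ c) (hρ : 0 ≤ ρ) (hρr : ‖R‖ * ρ ≤ r)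
    (h0 : ‖Φ 0‖ ≤ (1 - (κ + c * ‖R‖)) * ρ) {u : G} (hu : ‖u‖ ≤ ρ) :
    ‖u - Φ (R u)‖ ≤ ρ := by
  have h := norm_defectMap_sub_le Φ T R hΦ hR hc hρr hu (by rw [norm_zero]; exact hρ)
  rw [map_zero, sub_zero] at h
  have hF0 : ‖u - Φ (R u)‖ ≤ ‖(u - Φ (R u)) - (0 - Φ 0)‖ + ‖(0 : G) - Φ 0‖ := norm_le_norm_sub_add _ _
  rw [zero_sub, norm_neg] at hF0
  calc ‖u - Φ (R u)‖ ≤ ‖(u - Φ (R u)) - (0 - Φ 0)‖ + ‖Φ 0‖ := by rw [zero_sub]; exact hF0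
    _ ≤ (κ + c * ‖R‖) * ‖u‖ + (1 - (κ + c * ‖R‖)) * ρ := add_le_add h h0
    _ ≤ (κ + c * ‖R‖) * ρ + (1 - (κ + c * ‖R‖)) * ρ := by
        gcongr
    _ = ρ := by ring

/-! ## §2 The zero of `Φ` inside `range R` -/

section Complete

variable [CompleteSpace G]

/-- **★★ THE NEWTON∕IFT SHELL WITH AN APPROXIMATE RIGHT INVERSE, SOLUTION IN `range R`.**  Let `Φ : E → G` (`G` complete), `T : E →L G`, `R : G →L E`.  Suppose
(i) `Φ − T` is `c`-Lipschitz on the closed `r`-ball of `E`: `‖Φ x′ − Φ x − T (x′ − x)‖ ≤ c‖x′ − x‖`; (ii) `R` is a `κ`-APPROXIMATE right inverse of `T`: `‖T (R u) − u‖ ≤ κ‖u‖`;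
(iii) `κ + c‖R‖ < 1`; (iv) radii `0 ≤ ρ`, `‖R‖ρ ≤ r`; (v) SMALL DEFECT `‖Φ 0‖ ≤ (1 − κ − c‖R‖)·ρ`.  Then there is `u ∈ G` with `‖u‖ ≤ ρ` and `Φ (R u) = 0` — a zero of `Φ` inside
`R(closedBall 0 ρ) ⊆ closedBall 0 r` — and `‖u‖ ≤ ‖Φ 0‖ ∕ (1 − κ − c‖R‖)`.  Proof: `u ↦ u − Φ (R u)` is a `(κ + c‖R‖)`-contraction of the complete closed `ρ`-ball (§1); its fixed point is the
`u` sought (Banach).  The variant of Graves' theorem ∕ Mathlib's `ApproximatesLinearOn.surjOn_closedBall_of_nonlinearRightInverse` needed by the (FL) row: `R` need not invert the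
`T` that approximates `Φ` (only up to `κ`), and the zero lies in `range R`. [folklore] -/
theorem exists_zero_in_range_of_approxRightInverse (Φ : E → G) (T : E →L[𝕜] G) (R : G →L[𝕜] E) {c κ ρ r : ℝ}
    (hΦ : ∀ x ∈ closedBall (0 : E) r, ∀ x' ∈ closedBall (0 : E) r, ‖Φ x' - Φ x - T (x' - x)‖ ≤ c * ‖x' - x‖)
    (hR : ∀ u : G, ‖T (R u) - u‖ ≤ κ * ‖u‖) (hκ : 0 ≤ κ) (hc : 0 ≤ c) (hq : κ + c * ‖R‖ < 1) (hρ : 0 ≤ ρ) (hρr : ‖R‖ * ρ ≤ r)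
    (h0 : ‖Φ 0‖ ≤ (1 - (κ + c * ‖R‖)) * ρ) :
    ∃ u : G, ‖u‖ ≤ ρ ∧ Φ (R u) = 0 ∧ ‖u‖ ≤ ‖Φ 0‖ / (1 - (κ + c * ‖R‖)) := by
  have hq0 : 0 ≤ κ + c * ‖R‖ := add_nonneg hκ (mul_nonneg hc (norm_nonneg _))
  -- the closed `ρ`-ball of `G`, complete, mapped into itself by `F u := u - Φ (R u)`
  have hmaps : MapsTo (fun u : G => u - Φ (R u)) (closedBall (0 : G) ρ) (closedBall (0 : G) ρ) := by
    intro u hu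
    rw [mem_closedBall_zero_iff] at hu ⊢
    exact norm_defectMap_le Φ T R hΦ hR hκ hc hρ hρr h0 hu
  haveI : CompleteSpace (closedBall (0 : G) ρ) := isClosed_closedBall.completeSpace_coe
  have hlip : LipschitzWith ⟨κ + c * ‖R‖, hq0⟩ (hmaps.restrict _ _ _) := by
    refine LipschitzWith.of_dist_le_mul fun u u' => ?_
    rw [Subtype.dist_eq, Subtype.dist_eq, dist_eq_norm, dist_eq_norm]
    change ‖((u : G) - Φ (R u)) - ((u' : G) - Φ (R u'))‖ ≤ (κ + c * ‖R‖) * ‖(u : G) - u'‖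
    exact norm_defectMap_sub_le Φ T R hΦ hR hc hρr (mem_closedBall_zero_iff.mp u.2) (mem_closedBall_zero_iff.mp u'.2)
  have hcontr : ContractingWith ⟨κ + c * ‖R‖, hq0⟩ (hmaps.restrict _ _ _) := ⟨by exact_mod_cast hq, hlip⟩
  -- nonempty: `0 ∈ closedBall 0 ρ`
  haveI : Nonempty (closedBall (0 : G) ρ) := ⟨⟨0, mem_closedBall_zero_iff.mpr (by rw [norm_zero]; exact hρ)⟩⟩
  set x : closedBall (0 : G) ρ := ContractingWith.fixedPoint _ hcontr with hxdef
  have hx : hmaps.restrict _ _ _ x = x := ContractingWith.fixedPoint_isFixedPt hcontr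
  have hxρ : ‖(x : G)‖ ≤ ρ := mem_closedBall_zero_iff.mp x.2
  have hfix : (x : G) - Φ (R x) = x := congrArg Subtype.val hx
  have hzero : Φ (R (x : G)) = 0 := by
    have h := hfix
    rw [sub_eq_self] at h
    exact h
  refine ⟨x, hxρ, hzero, ?_⟩
  -- a-posteriori bound from `‖F x − F 0‖ ≤ q‖x − 0‖`
  have h := norm_defectMap_sub_le Φ T R hΦ hR hc hρr hxρ (by rw [norm_zero]; exact hρ)
  rw [hzero, map_zero, sub_zero, zero_sub, sub_neg_eq_add] at h
  have h1 : ‖(x : G)‖ ≤ ‖(x : G) + Φ 0‖ + ‖Φ 0‖ := by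
    have := norm_sub_le ((x : G) + Φ 0) (Φ 0)
    rwa [add_sub_cancel_right] at this
  rw [le_div_iff₀ (by linarith), mul_comm]
  nlinarith [h, h1]

/-- **THE SAME, FROM MATHLIB'S `ApproximatesLinearOn`** (`c : ℝ≥0`): `ApproximatesLinearOn Φ T (closedBall 0 r) c` is exactly hypothesis (i). [folklore] -/
theorem exists_zero_in_range_of_approxRightInverse' (Φ : E → G) (T : E →L[𝕜] G) (R : G →L[𝕜] E) {c : NNReal} {κ ρ r : ℝ}
    (hΦ : ApproximatesLinearOn Φ T (closedBall (0 : E) r) c)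
    (hR : ∀ u : G, ‖T (R u) - u‖ ≤ κ * ‖u‖) (hκ : 0 ≤ κ) (hq : κ + c * ‖R‖ < 1) (hρ : 0 ≤ ρ) (hρr : ‖R‖ * ρ ≤ r)
    (h0 : ‖Φ 0‖ ≤ (1 - (κ + c * ‖R‖)) * ρ) :
    ∃ u : G, ‖u‖ ≤ ρ ∧ Φ (R u) = 0 ∧ ‖u‖ ≤ ‖Φ 0‖ / (1 - (κ + c * ‖R‖)) :=
  exists_zero_in_range_of_approxRightInverse Φ T R (fun x hx x' hx' => hΦ x' hx' x hx) hR hκ c.2 hq hρ hρr h0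

end Complete

/-! ## §3 The approximate-right-inverse hypothesis from an operator-norm bound -/

/-- `‖T ∘ R − 1‖ ≤ κ` (operator norm) gives `‖T (R u) − u‖ ≤ κ‖u‖` for every `u`. [folklore] -/
theorem norm_apply_comp_sub_le_of_opNorm (T : E →L[𝕜] G) (R : G →L[𝕜] E) {κ : ℝ}
    (h : ‖T.comp R - ContinuousLinearMap.id 𝕜 G‖ ≤ κ) (u : G) : ‖T (R u) - u‖ ≤ κ * ‖u‖ := by
  have := (T.comp R - ContinuousLinearMap.id 𝕜 G).le_of_opNorm_le h u
  simpa using this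

/-- **ZERO IN THE IMAGE BALL.**  Repackaging of §2 for consumers that only want the correction `x = R u` with its norm: `∃ x ∈ R '' closedBall 0 ρ`, `‖x‖ ≤ ‖R‖ρ ≤ r`, `Φ x = 0`,
and `x = R u` with `‖u‖ ≤ ‖Φ 0‖ ∕ (1 − κ − c‖R‖)` (so any seminorm `p` with `p (R u) ≤ M‖u‖` — e.g. a curl bound on lifted corrections — is controlled by the initial defect).
[folklore] -/
theorem exists_zero_mem_image_of_approxRightInverse [CompleteSpace G] (Φ : E → G) (T : E →L[𝕜] G) (R : G →L[𝕜] E) {c κ ρ r : ℝ}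
    (hΦ : ∀ x ∈ closedBall (0 : E) r, ∀ x' ∈ closedBall (0 : E) r, ‖Φ x' - Φ x - T (x' - x)‖ ≤ c * ‖x' - x‖)
    (hR : ∀ u : G, ‖T (R u) - u‖ ≤ κ * ‖u‖) (hκ : 0 ≤ κ) (hc : 0 ≤ c) (hq : κ + c * ‖R‖ < 1) (hρ : 0 ≤ ρ) (hρr : ‖R‖ * ρ ≤ r)
    (h0 : ‖Φ 0‖ ≤ (1 - (κ + c * ‖R‖)) * ρ) (p : E → ℝ) {M : ℝ} (hM : 0 ≤ M) (hp : ∀ u : G, p (R u) ≤ M * ‖u‖) :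
    ∃ x : E, x ∈ R '' closedBall (0 : G) ρ ∧ ‖x‖ ≤ r ∧ Φ x = 0 ∧ p x ≤ M * (‖Φ 0‖ / (1 - (κ + c * ‖R‖))) := by
  obtain ⟨u, huρ, hu0, hub⟩ := exists_zero_in_range_of_approxRightInverse Φ T R hΦ hR hκ hc hq hρ hρr h0
  refine ⟨R u, ⟨u, by rwa [mem_closedBall, dist_zero_right], rfl⟩, ?_, hu0, (hp u).trans (mul_le_mul_of_nonneg_left hub hM)⟩
  exact (R.le_opNorm u).trans ((mul_le_mul_of_nonneg_left huρ (norm_nonneg _)).trans hρr)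

end Summit.QuantumFields.YangMills.Theorems.NewtonShell
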